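import Mathlib

/-!
# T5AmiceTransform — the power series `f_m` of a measure `m` on `ℤ_p`, and `∫ν dm = f_m(ζ_ν − 1)`

Cell pub-hodge-repro2, Tier 5 support (seat p7; route/T5-CHECK-G-p7.md §3 S5 / S6). §G's step S5 reads
«m := L⁻_{Σ,λ⁻¹,𝔭} ∈ W[[Γ_𝔭]] ≅ W[[T]] (γ₀ ↦ 1 + T), f_m ≠ 0 ⟺ m ≠ 0; for ν ∈ Ξ_𝔭 with ν(γ₀) = ζ:
∫ν dm = f_m(ζ − 1)» — the three sentences p8's T5FiniteZeros (p390575) takes as hypotheses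
(«measure ↔ power series», «∫ν dm = f(ζ − 1)», «|ζ − 1| < 1»; the third is T5PadicFiniteOrderCharacters).

In the cell's model a measure on `Γ_𝔭 ≅ ℤ_p` with values in a complete ultrametric normed `ℤ_p`-algebra
`R` is a continuous `R`-linear functional `m : C(ℤ_[p], R) →ₗ[R] R` (bounded = continuous,
`continuous_of_bound`). Mathlib's Mahler basis `mahler n = (x choose n)` then gives:

* `amice m := Σ_n m(x choose n) Tⁿ ∈ R[[T]]` — the Amice transform, the cell's `f_m` (`coeff_amice`);
* `map_addChar_eq_tsum_coeff`: for every continuous character `κ` of `ℤ_p`,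
  `m κ = Σ_n coeff_n(f_m) (κ 1 − 1)ⁿ` — «∫ν dm = f_m(ζ_ν − 1)» (Mathlib: `κ = mahlerSeries ((κ 1 − 1)^·)`,
  `PadicInt.eq_addChar_of_value_at_one`); in Mathlib's `PowerSeries.aeval` form when `R` is linearly
  topologised (`aeval_amice_eq_map`);
* `amice_eq_zero_iff` / `eq_of_amice_eq`: `f_m = 0 ⟺ m = 0`, the transform is injective on continuous
  functionals — «f_m ≠ 0 ⟺ m ≠ 0» (Mahler's theorem `PadicInt.hasSum_mahler`: every `f ∈ C(ℤ_p, R)` is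
  the sum of its Mahler series, so a continuous functional vanishing on the `(x choose n)` vanishes);
* `norm_coeff_amice_le`: the coefficients of `f_m` are bounded by the bound of `m`
  (`f_m ∈ 𝒪[[T]]` for an `𝒪`-valued measure).

What is NOT here: the Iwasawa-algebra isomorphism `W[[Γ_𝔭]] ≅ W[[T]]` as a ring isomorphism (the
transform is only shown linear and injective; convolution is not modelled), and the printed measures
themselves (the Katz measure is a particular `m`). Mathlib only.
-/

namespace Summit.Ventures.HodgeRepro2.T5AmiceTransform

open PadicInt Filter Topology
open scoped fwdDiff

variable {p : ℕ} [hp : Fact p.Prime]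
variable {R : Type*} [NormedCommRing R] [Algebra ℤ_[p] R] [IsBoundedSMul ℤ_[p] R]
  [IsUltrametricDist R]

omit [IsUltrametricDist R] in
/-- `mahlerTerm a n = a • mahlerTerm 1 n` in `C(ℤ_p, R)` (the `ℤ_p`-scalar `(x choose n)` commutes
with `a`). -/
theorem mahlerTerm_eq_smul (a : R) (n : ℕ) :
    (mahlerTerm a n : C(ℤ_[p], R)) = a • mahlerTerm (1 : R) n := by
  ext x
  simp only [mahlerTerm_apply, ContinuousMap.smul_apply, smul_eq_mul]
  rw [Algebra.smul_def, Algebra.smul_def, mul_one]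
  exact Algebra.commutes (R := ℤ_[p]) ((mahler n) x) a

omit [Algebra ℤ_[p] R] [IsBoundedSMul ℤ_[p] R] [IsUltrametricDist R] in
/-- A bounded linear functional on `C(ℤ_p, R)` is continuous. -/
theorem continuous_of_bound (m : C(ℤ_[p], R) →ₗ[R] R) (C : ℝ) (hm : ∀ f, ‖m f‖ ≤ C * ‖f‖) :
    Continuous m :=
  AddMonoidHomClass.continuous_of_bound m C hm

/-- THE AMICE TRANSFORM `f_m = Σ_n m(x choose n) Tⁿ` of a linear functional `m` on `C(ℤ_p, R)`. -/
noncomputable def amice (m : C(ℤ_[p], R) →ₗ[R] R) : PowerSeries R :=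
  PowerSeries.mk fun n => m (mahlerTerm (1 : R) n)

omit [IsUltrametricDist R] in
/-- The coefficients of `f_m` are the moments `m(x choose n)`. -/
@[simp] theorem coeff_amice (m : C(ℤ_[p], R) →ₗ[R] R) (n : ℕ) :
    PowerSeries.coeff n (amice m) = m (mahlerTerm (1 : R) n) :=
  PowerSeries.coeff_mk _ _

omit [IsUltrametricDist R] in
/-- `m (mahlerTerm a n) = a * m (mahlerTerm 1 n)`. -/
theorem map_mahlerTerm (m : C(ℤ_[p], R) →ₗ[R] R) (a : R) (n : ℕ) :
    m (mahlerTerm a n) = a * m (mahlerTerm (1 : R) n) := by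
  rw [mahlerTerm_eq_smul, map_smul, smul_eq_mul]

omit [IsUltrametricDist R] in
/-- The transform is additive. -/
theorem amice_add (m₁ m₂ : C(ℤ_[p], R) →ₗ[R] R) : amice (m₁ + m₂) = amice m₁ + amice m₂ := by
  ext n
  simp [coeff_amice]

omit [IsUltrametricDist R] in
/-- The transform respects subtraction. -/
theorem amice_sub (m₁ m₂ : C(ℤ_[p], R) →ₗ[R] R) : amice (m₁ - m₂) = amice m₁ - amice m₂ := by
  ext n
  simp [coeff_amice]

omit [IsUltrametricDist R] in
/-- The transform is `R`-linear. -/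
theorem amice_smul (c : R) (m : C(ℤ_[p], R) →ₗ[R] R) : amice (c • m) = c • amice m := by
  ext n
  simp [coeff_amice]

omit [IsUltrametricDist R] in
/-- The coefficients of `f_m` are bounded by the bound of `m` (`‖x choose n‖ = 1` uniformly):
for an `𝒪`-valued measure, `f_m ∈ 𝒪[[T]]`. -/
theorem norm_coeff_amice_le (m : C(ℤ_[p], R) →ₗ[R] R) (C : ℝ) (hm : ∀ f, ‖m f‖ ≤ C * ‖f‖) (n : ℕ) :
    ‖PowerSeries.coeff n (amice m)‖ ≤ C * ‖(1 : R)‖ := by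
  rw [coeff_amice]
  have := hm (mahlerTerm (1 : R) n)
  rwa [norm_mahlerTerm] at this

section Complete

variable [CompleteSpace R]

/-- Applying a continuous functional to a convergent Mahler series term by term:
`m (Σ_n (x choose n) a_n) = Σ_n a_n m(x choose n)` for `a_n → 0`. -/
theorem hasSum_map_mahlerSeries (m : C(ℤ_[p], R) →ₗ[R] R) (hm : Continuous m) {a : ℕ → R}
    (ha : Tendsto a atTop (𝓝 0)) :
    HasSum (fun n => a n * m (mahlerTerm (1 : R) n)) (m (mahlerSeries a)) := by
  have h := (hasSum_mahlerSeries ha).map m hm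
  convert h using 1
  funext n
  exact (map_mahlerTerm m (a n) n).symm

/-- MAHLER'S THEOREM, integrated: `m f = Σ_n (Δⁿ f)(0) · m(x choose n)` for every `f ∈ C(ℤ_p, R)`
and every continuous functional `m` (Mathlib's `PadicInt.hasSum_mahler`). -/
theorem hasSum_map_fwdDiff (m : C(ℤ_[p], R) →ₗ[R] R) (hm : Continuous m) (f : C(ℤ_[p], R)) :
    HasSum (fun n => ((fwdDiff (1 : ℤ_[p]))^[n] (⇑f) 0) * m (mahlerTerm (1 : R) n)) (m f) := by
  have h := (hasSum_mahler f).map m hm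
  convert h using 1
  funext n
  exact (map_mahlerTerm m _ n).symm

/-- `m f = Σ_n (Δⁿ f)(0) · m(x choose n)`. -/
theorem map_eq_tsum_fwdDiff (m : C(ℤ_[p], R) →ₗ[R] R) (hm : Continuous m) (f : C(ℤ_[p], R)) :
    m f = ∑' n, ((fwdDiff (1 : ℤ_[p]))^[n] (⇑f) 0) * m (mahlerTerm (1 : R) n) :=
  (hasSum_map_fwdDiff m hm f).tsum_eq.symm

/-- A continuous functional vanishing on every `(x choose n)` vanishes (Mahler's theorem). -/
theorem eq_zero_of_forall_map_mahlerTerm_eq_zero (m : C(ℤ_[p], R) →ₗ[R] R) (hm : Continuous m)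
    (h : ∀ n, m (mahlerTerm (1 : R) n) = 0) : m = 0 := by
  ext f
  rw [map_eq_tsum_fwdDiff m hm f, LinearMap.zero_apply]
  simp [h]

/-- «f_m = 0 ⟺ m = 0» for continuous functionals. -/
theorem amice_eq_zero_iff (m : C(ℤ_[p], R) →ₗ[R] R) (hm : Continuous m) :
    amice m = 0 ↔ m = 0 := by
  constructor
  · intro h
    apply eq_zero_of_forall_map_mahlerTerm_eq_zero m hm
    intro n
    have := congrArg (PowerSeries.coeff n) h
    rwa [coeff_amice, map_zero] at this
  · rintro rfl
    ext n
    simp [coeff_amice]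

/-- «f_m ≠ 0 ⟺ m ≠ 0» (the form p8's `T5FiniteZeros` consumes as `hf : f ≠ 0`). -/
theorem amice_ne_zero_iff (m : C(ℤ_[p], R) →ₗ[R] R) (hm : Continuous m) :
    amice m ≠ 0 ↔ m ≠ 0 :=
  (amice_eq_zero_iff m hm).not

/-- The Amice transform is injective on continuous functionals: `m ↦ f_m` identifies measures with
power series («W[[Γ_𝔭]] ≅ W[[T]]», injectivity half). -/
theorem eq_of_amice_eq {m₁ m₂ : C(ℤ_[p], R) →ₗ[R] R} (hm₁ : Continuous m₁) (hm₂ : Continuous m₂)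
    (h : amice m₁ = amice m₂) : m₁ = m₂ := by
  have hsub : amice (m₁ - m₂) = 0 := by rw [amice_sub, h, sub_self]
  have hc : Continuous (m₁ - m₂) := by
    have : ⇑(m₁ - m₂) = fun f => m₁ f - m₂ f := rfl
    rw [this]
    exact hm₁.sub hm₂
  have := (amice_eq_zero_iff (m₁ - m₂) hc).mp hsub
  exact sub_eq_zero.mp this

/-- A continuous character `κ` of `ℤ_p`, as an element of `C(ℤ_p, R)`, is the Mahler series
`Σ_n (x choose n) (κ 1 − 1)ⁿ` (Mathlib's `PadicInt.eq_addChar_of_value_at_one`). -/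
theorem addChar_eq_mahlerSeries (κ : AddChar ℤ_[p] R) (hκ : Continuous κ) :
    (⟨κ, hκ⟩ : C(ℤ_[p], R)) = mahlerSeries fun n => (κ 1 - 1) ^ n := by
  have hr : Tendsto (fun n : ℕ => (κ 1 - 1) ^ n) atTop (𝓝 0) := AddChar.tendsto_eval_one_sub_pow hκ
  have hκ' : κ = addChar_of_value_at_one (κ 1 - 1) hr :=
    eq_addChar_of_value_at_one hr hκ (by abel)
  ext x
  have hx := congrFun (coe_addChar_of_value_at_one hr) x
  rw [← hκ'] at hx
  exact hx

/-- «∫ν dm = f_m(ζ_ν − 1)»: for a continuous character `κ` of `ℤ_p` with `ζ = κ 1`,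
`m κ = Σ_n (ζ − 1)ⁿ · m(x choose n)`. -/
theorem hasSum_map_addChar (m : C(ℤ_[p], R) →ₗ[R] R) (hm : Continuous m) (κ : AddChar ℤ_[p] R)
    (hκ : Continuous κ) :
    HasSum (fun n => (κ 1 - 1) ^ n * m (mahlerTerm (1 : R) n)) (m ⟨κ, hκ⟩) := by
  rw [addChar_eq_mahlerSeries κ hκ]
  exact hasSum_map_mahlerSeries m hm (AddChar.tendsto_eval_one_sub_pow hκ)

/-- «∫ν dm = f_m(ζ_ν − 1)» with the coefficients of `f_m = amice m`:
`m κ = Σ_n coeff_n(f_m) (κ 1 − 1)ⁿ`. -/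
theorem hasSum_coeff_amice_mul_pow (m : C(ℤ_[p], R) →ₗ[R] R) (hm : Continuous m)
    (κ : AddChar ℤ_[p] R) (hκ : Continuous κ) :
    HasSum (fun n => PowerSeries.coeff n (amice m) * (κ 1 - 1) ^ n) (m ⟨κ, hκ⟩) := by
  have h := hasSum_map_addChar m hm κ hκ
  simp only [coeff_amice]
  simpa only [mul_comm] using h

/-- «∫ν dm = f_m(ζ_ν − 1)», tsum form. -/
theorem map_addChar_eq_tsum_coeff (m : C(ℤ_[p], R) →ₗ[R] R) (hm : Continuous m)
    (κ : AddChar ℤ_[p] R) (hκ : Continuous κ) :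
    m ⟨κ, hκ⟩ = ∑' n, PowerSeries.coeff n (amice m) * (κ 1 - 1) ^ n :=
  (hasSum_coeff_amice_mul_pow m hm κ hκ).tsum_eq.symm

omit [CompleteSpace R] in
/-- `ζ_ν − 1 = κ 1 − 1` is a legitimate evaluation point of power series (topologically nilpotent). -/
theorem hasEval_eval_one_sub_one (κ : AddChar ℤ_[p] R) (hκ : Continuous κ) :
    PowerSeries.HasEval (κ 1 - 1) :=
  AddChar.tendsto_eval_one_sub_pow hκ

/-- «∫ν dm = f_m(ζ_ν − 1)» in Mathlib's `PowerSeries.aeval` form (for `R` linearly topologised, e.g. a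
ring of integers): `f_m(κ 1 − 1) = m κ`. This is exactly the evaluation family
`ν ↦ aeval (ζ_ν − 1) f` of p8's `finite_aevalZeroSet`, with `f := amice m`. -/
theorem aeval_amice_eq_map [IsLinearTopology R R] (m : C(ℤ_[p], R) →ₗ[R] R) (hm : Continuous m)
    (κ : AddChar ℤ_[p] R) (hκ : Continuous κ) :
    PowerSeries.aeval (hasEval_eval_one_sub_one κ hκ) (amice m) = m ⟨κ, hκ⟩ := by
  rw [PowerSeries.aeval_eq_sum, map_addChar_eq_tsum_coeff m hm κ hκ]
  simp only [smul_eq_mul]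

/-- `∫ν dm = 0 ⟺ f_m(ζ_ν − 1) = 0`: the zero set of `ν ↦ ∫ν dm` on continuous characters is the zero
set of the evaluation family of `f_m` (the set S5 bounds by `deg P` after Weierstrass). -/
theorem map_addChar_eq_zero_iff [IsLinearTopology R R] (m : C(ℤ_[p], R) →ₗ[R] R)
    (hm : Continuous m) (κ : AddChar ℤ_[p] R) (hκ : Continuous κ) :
    m ⟨κ, hκ⟩ = 0 ↔ PowerSeries.aeval (hasEval_eval_one_sub_one κ hκ) (amice m) = 0 := by
  rw [aeval_amice_eq_map m hm κ hκ]

end Complete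

end Summit.Ventures.HodgeRepro2.T5AmiceTransform
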